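import Summits.ABC.StewartYu.GenThreeStepTwo
import Summits.ABC.StewartYu.GenThreeEndExits
import HarnessLib

/-!
# Cell abc-stewartyu, Gen-3 frame at `p = 2` (crux `Y07Two`, stmt-ABC-19659): the FRAME SPEC — the
# per-rank dichotomy from «extrapolation output + record numerics», typed and proved

`Summits/ABC/StewartYu/GenThreeFrameSpecTwo.lean` — cell `abc-stewartyu` (HOME `run/shared/lean/pub/abc-stewartyu/`),
route `PadicPrimesKummerThird`, seat p3 (g5), F-two LEAD of the crux `Y07Two`.  One auxiliary definition
(the `b`-hyperplane `𝔚` of `Lie G` as a `Submodule`), three `Prop`-valued predicates (the interface between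
the analytic FRAME and the numeric RECORD), theorems.  No named fact, no analytic content.

With `GenThreeInductionTwo` (Matveev's induction shell), `GenThreeStepTwo` (the step glue) and
`GenThreeEndExits` (the zero estimate's END with exits, `H` kept), the registered stub
`stub_engineTwo : Nesterenko2003_prop51 → GenThreeEngineTwo` of the crux `Y07Two` is the conjunction of two
deliverables at each rank `n`, which this file states as predicates and composes:

* `FrameOutputTwo n α b j₀ D₀ S₀ X D` — what the ANALYTIC FRAME (auxiliary polynomial by Siegel's lemma,
  `2`-adic extrapolation with the `q = 3` Kummer descent, Nesterenko/Yu 2013 §5) must deliver for a rank-`n`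
  datum under the NEGATED bound: a nonzero Laurent polynomial `P = ∑_{(a,κ) ∈ I} q(a,κ) Y₀^a Y^κ` with
  `a ≤ D₀`, `|κⱼ| ≤ Dⱼ`, whose `𝔚`-derivatives of total order `≤ (n+1)S₀` vanish at the points `(x, αˣ)`,
  `|x| ≤ (n+1)X` — written out as the scalar identities (5.4) with the directional scalars
  `b_{j₀}κₖ − bₖκ_{j₀}` (pivot `b j₀ ≠ 0`), i.e. EXACTLY the `hL` input of
  `GenThreeEndExits.exists_exits_rat` with `ι = ℕ × (Fin n → ℤ)`, `a = Prod.fst`, `κ = Prod.snd`;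
* `RecordTwo C n V Vmax W D₀ S₀ X D` — what the RECORD (parameter ledger, Yu 2013 (3.1)–(3.9) at `p = 2`,
  Nesterenko (5.5)–(5.8), (5.14)–(5.17), Lemma 5.4, (5.22)) must verify for those parameters: exit A is
  numerically impossible; exit B/C with `r = n` is impossible; and for `0 < r < n` the exit-C inequality
  implies the (5.22) cost line of `GenThreeStepTwo.stepTwo_of_exitC` for every non-singular `r × r` minor;
* `FrameTwo C n` — for every rank-`n` datum of `CoreTwo` under the negated bound, SOME pivot and parameters
  with `FrameOutputTwo ∧ RecordTwo`.

Theorems: `dichotomyTwo_of_frame : Nesterenko2003_prop51 → 0 ≤ C n… → FrameTwo C n → DichotomyTwo C n` and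
the end-to-end reduction **`engineTwo_of_frame`: the frozen `GenThreeEngineTwo` text from
`Nesterenko2003_prop51`, an admissible `C ≤ c₁ⁿ`, and `∀ n, FrameTwo C n`** — so the lead's remaining work
on `stub_engineTwo` is literally `∀ n, FrameTwo C n` for one explicit `C`.

WHAT THIS IS NOT: the frame and the record themselves; no crux moves.

References: Yu. V. Nesterenko, LNM 1819 (2003), §5.1 (5.4)–(5.8), §5.2 (5.9)–(5.17), (5.22), Lemma 5.4;
K. Yu, Acta Math. 211 (2013), §3.1, §5 (5.19)–(5.20), §6.
-/

noncomputable section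

open Finset
open Literature.NumberTheory.Transcendental
open Literature.NumberTheory.Transcendental.GaGm

namespace Summit.ABC.StewartYu.GenThreeFrameSpecTwo

open Summit.ABC.StewartYu.GenThreeInductionTwo
open Summit.ABC.StewartYu.GenThreeStepTwo
open Summit.ABC.StewartYu.GenThreeEndExits

variable {n : ℕ}

/-! ### The `b`-hyperplane `𝔚 ⊂ Lie G = ℂ × ℂⁿ` -/

/-- **The hyperplane `𝔚 = {(w₀, w) : ∑ⱼ bⱼ wⱼ = 0}` of `Lie(𝔾ₐ × 𝔾ₘⁿ)`** along which the auxiliary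
polynomial vanishes to high order (Baker–Wüstholz's `b`-eliminated derivations together with `∂/∂Y₀`).
[cite: Nesterenko2003, §5.1 (5.4)] -/
def bHyperplane (b : Fin n → ℤ) : Submodule ℂ (ℂ × (Fin n → ℂ)) where
  carrier := {w | ∑ j, (b j : ℂ) * w.2 j = 0}
  add_mem' := by
    intro u v hu hv
    simp only [Set.mem_setOf_eq, Prod.snd_add, Pi.add_apply] at hu hv ⊢
    rw [show ∑ j, (b j : ℂ) * (u.2 j + v.2 j) = ∑ j, (b j : ℂ) * u.2 j + ∑ j, (b j : ℂ) * v.2 j by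
      rw [← Finset.sum_add_distrib]; exact Finset.sum_congr rfl fun j _ => by ring, hu, hv, add_zero]
  zero_mem' := by simp
  smul_mem' := by
    intro c u hu
    simp only [Set.mem_setOf_eq, Prod.smul_snd, Pi.smul_apply, smul_eq_mul] at hu ⊢
    rw [show ∑ j, (b j : ℂ) * (c * u.2 j) = c * ∑ j, (b j : ℂ) * u.2 j by
      rw [Finset.mul_sum]; exact Finset.sum_congr rfl fun j _ => by ring, hu, mul_zero]

/-- Membership in `𝔚`. [cite: Nesterenko2003, §5.1 (5.4)] -/
theorem mem_bHyperplane (b : Fin n → ℤ) (w : ℂ × (Fin n → ℂ)) :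
    w ∈ bHyperplane b ↔ ∑ j, (b j : ℂ) * w.2 j = 0 := Iff.rfl

/-! ### The two deliverables, as predicates -/

/-- **FRAME OUTPUT at rank `n`** (the analytic frame's deliverable under the negated bound): a nonzero
Laurent polynomial `P = ∑_{(a,κ) ∈ I} q(a,κ)·Y₀^a·Y^κ`, `a ≤ D₀`, `|κⱼ| ≤ Dⱼ`, whose `𝔚`-derivatives of
total order `≤ (n+1)S₀` vanish at the points `(x, αˣ)`, `|x| ≤ (n+1)X`, as the scalar identities (5.4) with
pivot `j₀`. [cite: Nesterenko2003, §5.1 (5.1)–(5.4)] -/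
def FrameOutputTwo (n : ℕ) (α : Fin n → ℚ) (b : Fin n → ℤ) (j₀ : Fin n) (D₀ S₀ X : ℕ)
    (D : Fin n → ℕ) : Prop :=
  ∃ (I : Finset (ℕ × (Fin n → ℤ))) (q : ℕ × (Fin n → ℤ) → ℂ) (i₀ : ℕ × (Fin n → ℤ)),
    (∀ i ∈ I, i.1 ≤ D₀) ∧ (∀ i ∈ I, ∀ j, |i.2 j| ≤ (D j : ℤ)) ∧ i₀ ∈ I ∧ q i₀ ≠ 0 ∧
    ∀ x : ℤ, |x| ≤ (((n + 1) * X : ℕ) : ℤ) → ∀ (t : ℕ) (ν : Fin n → ℕ), ν j₀ = 0 →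
      t + ∑ k, ν k ≤ (n + 1) * S₀ →
      ∑ i ∈ I, q i * (((i.1).descFactorial t : ℕ) : ℂ) * ((x : ℂ) * 1) ^ (i.1 - t) *
        (∏ k, ((b j₀ : ℂ) * (i.2 k : ℂ) - (b k : ℂ) * (i.2 j₀ : ℂ)) ^ ν k) *
        ∏ j, ((α j : ℂ)) ^ (x * i.2 j) = 0

/-- **RECORD OBLIGATIONS at rank `n`** for the parameters `(D₀, S₀, X, D)` and the weights: (A) exit A of
the zero estimate is numerically impossible ((5.14)–(5.17)); (B) exit B/C with a character lattice of full
rank `r = n` is impossible (Lemma 5.4); (C) for `0 < r < n`, the exit-C inequality implies the (5.22) cost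
line of `GenThreeStepTwo.stepTwo_of_exitC` for every non-singular `r × r` minor `κ`.
[cite: Nesterenko2003, §5.2 (5.14)–(5.17), Lemma 5.4, (5.22)] -/
def RecordTwo (C : ℕ → ℝ) (n : ℕ) (V : Fin n → ℝ) (Vmax W : ℝ) (D₀ S₀ X : ℕ) (D : Fin n → ℕ) :
    Prop :=
  (∀ (r d₀ : ℕ) (M : Matrix (Fin r) (Fin n) ℤ), r ≤ n → d₀ ≤ 1 →
      LinearIndependent ℤ (fun i => M i) →
      ¬ (Nat.choose (S₀ + (r + 1 - d₀)) (r + 1 - d₀) * (2 * X + 1) * nesterenkoH n r d₀ M D₀ D ≤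
          (n + 1).factorial * 2 ^ n * D₀ * ∏ j, D j)) ∧
  (∀ (d₀ : ℕ) (M : Matrix (Fin n) (Fin n) ℤ), d₀ ≤ 1 → LinearIndependent ℤ (fun i => M i) →
      ¬ (Nat.choose (S₀ + (n - d₀)) (n - d₀) * (2 * X + 1) * nesterenkoH n n d₀ M D₀ D ≤
          (n + 1).factorial * 2 ^ n * D₀ * ∏ j, D j)) ∧
  (∀ (r d₀ : ℕ) (M : Matrix (Fin r) (Fin n) ℤ), 0 < r → r < n → d₀ ≤ 1 →
      LinearIndependent ℤ (fun i => M i) →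
      Nat.choose (S₀ + (r - d₀)) (r - d₀) * (2 * X + 1) * nesterenkoH n r d₀ M D₀ D ≤
          (n + 1).factorial * 2 ^ n * D₀ * ∏ j, D j →
      ∀ κ : Fin r → Fin n, Function.Injective κ →
        (Matrix.of fun i j => (M j (κ i) : ℝ)).det ≠ 0 →
        C r * (((r.factorial : ℝ)) ^ 2 * (n : ℝ) ^ r *
                (|(Matrix.of fun i j => (M j (κ i) : ℝ)).det| * ∏ i, V (κ i))) *
            (W + Real.log 3 + Real.log n + Real.log Vmax +
              Real.log (((r.factorial : ℝ)) ^ 2 * (n : ℝ) ^ r *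
                (|(Matrix.of fun i j => (M j (κ i) : ℝ)).det| * ∏ i, V (κ i))) +
              Real.log (2 * (((r.factorial : ℝ)) ^ 2 * (n : ℝ) ^ r *
                (|(Matrix.of fun i j => (M j (κ i) : ℝ)).det| * ∏ i, V (κ i))))) ≤
          C n * (∏ j, V j) * (W + Real.log (2 * Vmax)))

/-- **THE FRAME at rank `n`** (what the lead still owes for `stub_engineTwo`, per rank): for every rank-`n`
datum of the internal statement under the NEGATED bound, a pivot `b j₀ ≠ 0` and parameters with the frame
output and the record obligations. [cite: Nesterenko2003, §5; shape only] -/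
def FrameTwo (C : ℕ → ℝ) (n : ℕ) : Prop :=
  ∀ (α : Fin n → ℚ) (b : Fin n → ℤ) (V : Fin n → ℝ) (Vmax W : ℝ),
    (∀ j, 3 ≤ padicValRat 2 (α j - 1)) →
    (∀ μ : Fin n → ℤ, ∏ j, α j ^ μ j = 1 → μ = 0) →
    (∀ κ : Fin n → ℤ, (∃ γ : ℚ, ∏ j, α j ^ κ j = γ ^ 3) → ∀ j, (3 : ℤ) ∣ κ j) →
    (∀ j, Height.logHeight₁ (α j) ≤ V j) → (∀ j, 1 ≤ V j) → (∀ j, V j ≤ Vmax) →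
    b ≠ 0 → (∀ j, Real.log (max 3 (|b j| : ℝ)) ≤ W) → 1 ≤ W →
    ¬ (padicValRat 2 (∏ j, α j ^ b j - 1) : ℝ) ≤ C n * (∏ j, V j) * (W + Real.log (2 * Vmax)) →
    ∃ (j₀ : Fin n) (D₀ S₀ X : ℕ) (D : Fin n → ℕ), b j₀ ≠ 0 ∧
      FrameOutputTwo n α b j₀ D₀ S₀ X D ∧ RecordTwo C n V Vmax W D₀ S₀ X D

/-! ### Composition -/

/-- **The per-rank dichotomy from the frame.**  Zero estimate (named fact) + frame output ⇒ the END with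
exits (`exists_exits_rat` on `𝔚 = bHyperplane b`); exit A and full rank are refuted by the record; exit C
with `0 < r < n` is the Matveev step (`stepTwo_of_exitC`) closed by the record's (5.22) line.
[cite: Nesterenko2003, §5.2] -/
theorem dichotomyTwo_of_frame (hZ : Nesterenko2003_prop51) {C : ℕ → ℝ} (hC0 : ∀ r, 0 ≤ C r)
    (hF : FrameTwo C n) : DichotomyTwo C n := by
  classical
  refine dichotomyTwo_of_not_le ?_
  intro α b V Vmax W hα hind hK hV hV1 hVmax hb hW hW1 hneg
  obtain ⟨j₀, D₀, S₀, X, D, hbj₀, hout, hrecA, hrecB, hrecC⟩ :=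
    hF α b V Vmax W hα hind hK hV hV1 hVmax hb hW hW1 hneg
  obtain ⟨I, q, i₀, ha, hκ, hi₀, hq, hL⟩ := hout
  have hα0 : ∀ j, α j ≠ 0 := fun j => TwoSetup.ne_zero_of_three_le (hα j)
  have hinj : Set.InjOn (fun i : ℕ × (Fin n → ℤ) => (i.1, i.2)) (I : Set (ℕ × (Fin n → ℤ))) := by
    intro x _ y _ h
    exact Prod.ext (congrArg Prod.fst h) (congrArg Prod.snd h)
  obtain ⟨H, r, M, hrn, hd, hM, hchars, hexits⟩ :=
    exists_exits_rat hZ α hα0 hind b j₀ hbj₀ (bHyperplane b) (mem_bHyperplane b) I Prod.fst Prod.snd q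
      D₀ S₀ X D ha hκ hinj hi₀ hq hL
  rcases hexits with ⟨_hnex, hineqA⟩ | ⟨hex, hineqC⟩
  · -- exit A: refuted by the record
    exact absurd hineqA (hrecA r H.addDim M hrn hd hM)
  · -- exit B/C
    rcases Nat.lt_or_ge r n with hlt | hge
    · -- `r < n`: Matveev's step
      have hr0 : 0 < r := pos_of_exitC b hb (fun i => M i) hex
      have hbM := span_rat_of_exitC b (fun i => M i) hex
      exact stepTwo_of_exitC hr0 hlt (hC0 r) α hα hind hK V Vmax W hV hV1 hVmax b hb hW hW1 H
        (fun i => M i) hM hchars hbM (hrecC r H.addDim M hr0 hlt hd hM hineqC)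
    · -- `r = n`: refuted by the record (Lemma 5.4)
      have hrn' : r = n := le_antisymm hrn hge
      subst hrn'
      exact absurd hineqC (hrecB H.addDim M hd hM)

/-- **END-TO-END: the frozen `GenThreeEngineTwo` text from the zero estimate, an admissible constant
function and the frame at every rank.**  This is the registered stub
`stub_engineTwo : Nesterenko2003_prop51 → GenThreeEngineTwo` of the crux `Y07Two` reduced to
`∀ n, FrameTwo C n`. [cite: Yu2007, Main Thm (K = ℚ, ℘ = 2); shape only] -/
theorem engineTwo_of_frame {C : ℕ → ℝ} {c₁ : ℝ} (hc₁ : 1 ≤ c₁) (hC : ∀ m, 0 ≤ C m ∧ C m ≤ c₁ ^ m)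
    (hF : Nesterenko2003_prop51 → ∀ n, FrameTwo C n) (hZ : Nesterenko2003_prop51) :
    ∃ (C : ℕ → ℝ) (c₁ : ℝ), 1 ≤ c₁ ∧ (∀ m, 0 ≤ C m ∧ C m ≤ c₁ ^ m) ∧
      ∀ (m : ℕ) (α : Fin m → ℚ) (b : Fin m → ℤ) (V : Fin m → ℝ) (Vmax W : ℝ),
        (∀ j, ∃ a : ℤ, α j = a) →
        (∀ j, 3 ≤ padicValRat 2 (α j - 1)) →
        (∀ μ : Fin m → ℤ, ∏ j, α j ^ μ j = 1 → μ = 0) →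
        (∀ κ : Fin m → ℕ, (∃ j, ¬ 3 ∣ κ j) → ∀ γ : ℚ, ∏ j, α j ^ κ j ≠ γ ^ 3) →
        (∀ j, Height.logHeight₁ (α j) ≤ V j) → (∀ j, 1 ≤ V j) → (∀ j, V j ≤ Vmax) →
        b ≠ 0 → (∀ j, Real.log (max 3 (|b j| : ℝ)) ≤ W) → 1 ≤ W →
        (padicValRat 2 (∏ j, α j ^ b j - 1) : ℝ) ≤ C m * (∏ j, V j) * (W + Real.log (2 * Vmax)) :=
  engineTwo_of_dichotomy hc₁ hC
    (fun hZ' n => dichotomyTwo_of_frame hZ' (fun r => (hC r).1) (hF hZ' n)) hZ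

end Summit.ABC.StewartYu.GenThreeFrameSpecTwo

end
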